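import Mathlib.Analysis.SpecialFunctions.Integrals.Basic
import Mathlib.MeasureTheory.Measure.Lebesgue.VolumeOfBalls
import Mathlib.Analysis.Real.Pi.Bounds
import Literature.Analysis.FunctionSpaces.SobolevImbeddingSup
import HarnessLib

/-!
# An EXPLICIT sup-norm interpolation between `L²` and `Ḣ²` on three-dimensional space
# (Gagliardo–Nirenberg, `j = 0`, `m = 2`, `p = ∞`, `q = r = 2`, `n = 3`), with numerical constants
# and no Sobolev constant

Analysis/FunctionSpaces proof file (theorems only; no definitions, no named facts, no `sorry`).
For a `C²` map `f : ℝ³ → F` with `f, D²f ∈ L²` and every `ρ > 0`, `x ∈ ℝ³`: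

  `‖f(x)‖ ≤ (5/4) ρ^{-3/2} ‖f‖_{L²} + 2 ρ^{1/2} ‖D²f‖_{L²}`        (`norm_le_sup_interpolation_two`)

(hence `‖f‖_∞ ≲ ‖f‖₂^{1/4} ‖D²f‖₂^{3/4}`, Nirenberg 1959, Lecture II, the inequality
`|Dʲu|_p ≤ C |Dᵐu|_r^a |u|_q^{1−a}` in the case `n = 3, j = 0, m = 2, p = ∞, q = r = 2, a = 3/4`;
Adams 1975, Thm. 5.4 Part I Case C, `W^{2,2}(ℝ³) ⊂ C_B(ℝ³)`). The point of the file is the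
CONSTANTS: unlike the tree's `norm_apply_le_agmon` (`agmonConst` = Newton-kernel integrals ×
Mathlib's irreducible Gagliardo–Nirenberg–Sobolev constant) and
`exists_enorm_le_sobolev_two_two_dim_three` (an existential finite constant), the bound here is a
pair of numerals, which is what an a-posteriori (certificate) door needs to turn a weighted
`L² ⊕ Ḣ²` energy of a difference of two flows into a pointwise distance.

## The argument (second differences averaged over a ball; no Fourier transform, no Sobolev inequality)

For `z ∈ ℝ³`, `h(2z) − 2h(z) + h(0) = ∫₀¹∫₀¹ D²h((s+t)z)[z, z] ds dt` (the fundamental theorem of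
calculus twice along the segment), so `‖h(2z) − 2h(z) + h(0)‖ ≤ ‖z‖² ∫₀¹∫₀¹ ‖D²h((s+t)z)‖`
(`enorm_second_difference_le`). Averaging `h(0) = 2h(z) − h(2z) + Δ²_z h(0)` over `z ∈ B_ρ`:
`μ(B_ρ)‖h(0)‖ ≤ 2∫_{B_ρ}‖h‖ + ∫_{B_ρ}‖h(2·)‖ + ρ² ∫₀¹∫₀¹ ∫_{B_ρ} ‖D²h((s+t)z)‖ dz`; by the
substitution `w = (s+t)z` (Jacobian `(s+t)^{-3}`, `Measure.map_addHaar_smul`) and Cauchy–Schwarz on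
`B_{(s+t)ρ}`, `∫_{B_ρ}‖D²h((s+t)z)‖dz ≤ (s+t)^{-3/2} μ(B_ρ)^{1/2} ‖D²h‖_{L²}`, and the weight
`∫₀¹∫₀¹ (s+t)^{-3/2} ds dt = 8 − 4√2 ≤ 4` is finite — whereas the first-order Taylor average, with
weight `∫₀¹ t^{-3/2} dt`, is not: this is why a SECOND difference is used
(`lintegral_second_difference_weight_le`). The two `L²` terms are `≤ μ(B_ρ)^{1/2}‖h‖₂` and
`≤ 8^{-1/2} μ(B_ρ)^{1/2} ‖h‖₂ ≤ ½ μ(B_ρ)^{1/2}‖h‖₂` (`second_difference_pointwise`, any real normed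
space of dimension `3` with a Haar measure). On `ℝ³` with Lebesgue measure `μ(B_ρ) = (4π/3)ρ³ ≥ 4ρ³`
gives the displayed numerals (`norm_le_sup_interpolation_two`; translation to a general point `x`).
The pattern (segment formula, average over a ball, Haar scaling, Hölder on the scaled ball) is that
of the tree's `morrey_pointwise` (Adams 1975, Lemma 5.15/5.17), one order higher.

## References

* L. Nirenberg, Ann. Sc. Norm. Super. Pisa (3) 13 (1959) 115–162, Lecture II (the interpolation
  inequality). [Nirenberg1959]
* R. A. Adams, *Sobolev Spaces* (1975), Thm. 5.4 Part I Case C; Lemmas 5.15, 5.17. [Adams1975]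
-/

noncomputable section

open MeasureTheory Metric Set Filter Topology Module
open scoped ENNReal NNReal ContDiff

namespace Literature.Analysis.FunctionSpaces

variable {E : Type*} [NormedAddCommGroup E] [NormedSpace ℝ E]
variable {F : Type*} [NormedAddCommGroup F] [NormedSpace ℝ F]

/-! ### The second difference along a segment -/

/-- **Second difference along a segment.** For a `C²` map `h` and `z ∈ E`,
`‖h(2z) − 2h(z) + h(0)‖ ≤ ∫₀¹∫₀¹ ‖D²h((s+t)z)‖ ‖z‖² ds dt` (in `ℝ≥0∞` form):
`h(2z) − 2h(z) + h(0) = ∫₀¹ (ψ(t+1) − ψ(t)) dt` with `ψ(σ) = Dh(σz) z`, and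
`ψ(t+1) − ψ(t) = ∫₀¹ D²h((s+t)z)[z, z] ds` (fundamental theorem of calculus twice).
[cite: Adams1975, Lemma 5.15 (segment formula of the proof of Lemma 5.17, applied twice)] -/
theorem enorm_second_difference_le [CompleteSpace F] {h : E → F} (hh : ContDiff ℝ 2 h) (z : E) :
    ‖h ((2 : ℝ) • z) - (2 : ℝ) • h z + h 0‖ₑ ≤
      ∫⁻ t in Ioc (0 : ℝ) 1, ∫⁻ s in Ioc (0 : ℝ) 1,
        ‖iteratedFDeriv ℝ 2 h ((s + t) • z)‖ₑ * ‖z‖ₑ ^ 2 := by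
  have hD1 : ContDiff ℝ 1 (fderiv ℝ h) := hh.fderiv_right (m := 1) (by norm_num)
  have hdiff : Differentiable ℝ h := hh.differentiable (by norm_num)
  have hdiffD : Differentiable ℝ (fderiv ℝ h) := hD1.differentiable one_ne_zero
  -- `ψ(σ) = Dh(σ z) z` and its derivative `ψ'(σ) = D²h(σ z)[z, z]`
  have hseg : ∀ σ : ℝ, HasDerivAt (fun s : ℝ => s • z) z σ := fun σ => by
    simpa using (hasDerivAt_id σ).smul_const z
  have hφ : ∀ σ : ℝ, HasDerivAt (fun s : ℝ => h (s • z)) (fderiv ℝ h (σ • z) z) σ := fun σ =>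
    (hdiff (σ • z)).hasFDerivAt.comp_hasDerivAt σ (hseg σ)
  have hψ : ∀ σ : ℝ, HasDerivAt (fun s : ℝ => fderiv ℝ h (s • z) z)
      (fderiv ℝ (fderiv ℝ h) (σ • z) z z) σ := by
    intro σ
    have h1 : HasDerivAt (fun s : ℝ => fderiv ℝ h (s • z)) (fderiv ℝ (fderiv ℝ h) (σ • z) z) σ :=
      (hdiffD (σ • z)).hasFDerivAt.comp_hasDerivAt σ (hseg σ)
    have h2 := h1.clm_apply (hasDerivAt_const σ z)
    simpa using h2
  -- continuity
  have cψ : Continuous fun s : ℝ => fderiv ℝ h (s • z) z :=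
    ((hh.continuous_fderiv (by norm_num)).comp (continuous_id.smul continuous_const)).clm_apply
      continuous_const
  have cD2 : Continuous fun s : ℝ => fderiv ℝ (fderiv ℝ h) (s • z) :=
    (hD1.continuous_fderiv one_ne_zero).comp (continuous_id.smul continuous_const)
  have cψ' : Continuous fun s : ℝ => fderiv ℝ (fderiv ℝ h) (s • z) z z :=
    (cD2.clm_apply continuous_const).clm_apply continuous_const
  -- first fundamental theorem: `∫ₐᵇ ψ = h(b z) − h(a z)`
  have hFTC0 : ∀ a b : ℝ, ∫ s in a..b, fderiv ℝ h (s • z) z = h (b • z) - h (a • z) := fun a b =>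
    intervalIntegral.integral_eq_sub_of_hasDerivAt (fun s _ => hφ s) (cψ.intervalIntegrable _ _)
  -- second: `∫₀¹ ψ'(s + t) ds = ψ(t + 1) − ψ(t)`
  have hFTC1 : ∀ t : ℝ, ∫ s in (0 : ℝ)..1, fderiv ℝ (fderiv ℝ h) ((s + t) • z) z z =
      fderiv ℝ h ((1 + t) • z) z - fderiv ℝ h (t • z) z := by
    intro t
    have h1 : ∫ s in (0 : ℝ)..1, fderiv ℝ (fderiv ℝ h) ((s + t) • z) z z =
        ∫ σ in (0 + t : ℝ)..(1 + t), fderiv ℝ (fderiv ℝ h) (σ • z) z z :=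
      intervalIntegral.integral_comp_add_right (fun σ => fderiv ℝ (fderiv ℝ h) (σ • z) z z) t
    rw [h1, zero_add]
    exact intervalIntegral.integral_eq_sub_of_hasDerivAt (fun s _ => hψ s) (cψ'.intervalIntegrable _ _)
  -- the second difference as a double integral
  have hΔ : h ((2 : ℝ) • z) - (2 : ℝ) • h z + h 0 =
      ∫ t in (0 : ℝ)..1, ∫ s in (0 : ℝ)..1, fderiv ℝ (fderiv ℝ h) ((s + t) • z) z z := by
    have e1 : ∫ t in (0 : ℝ)..1, ∫ s in (0 : ℝ)..1, fderiv ℝ (fderiv ℝ h) ((s + t) • z) z z =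
        ∫ t in (0 : ℝ)..1, (fderiv ℝ h ((1 + t) • z) z - fderiv ℝ h (t • z) z) :=
      intervalIntegral.integral_congr fun t _ => hFTC1 t
    have cshift : Continuous fun t : ℝ => fderiv ℝ h ((1 + t) • z) z :=
      cψ.comp (continuous_const.add continuous_id)
    have e2 : ∫ t in (0 : ℝ)..1, (fderiv ℝ h ((1 + t) • z) z - fderiv ℝ h (t • z) z) =
        (∫ t in (0 : ℝ)..1, fderiv ℝ h ((1 + t) • z) z) - ∫ t in (0 : ℝ)..1, fderiv ℝ h (t • z) z :=
      intervalIntegral.integral_sub (cshift.intervalIntegrable _ _) (cψ.intervalIntegrable _ _)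
    have e3 : ∫ t in (0 : ℝ)..1, fderiv ℝ h ((1 + t) • z) z = h ((2 : ℝ) • z) - h ((1 : ℝ) • z) := by
      have h1 : ∫ t in (0 : ℝ)..1, fderiv ℝ h ((1 + t) • z) z =
          ∫ σ in (1 + 0 : ℝ)..(1 + 1), fderiv ℝ h (σ • z) z :=
        intervalIntegral.integral_comp_add_left (fun σ => fderiv ℝ h (σ • z) z) 1
      rw [h1, hFTC0]
      norm_num
    have e4 : ∫ t in (0 : ℝ)..1, fderiv ℝ h (t • z) z = h ((1 : ℝ) • z) - h ((0 : ℝ) • z) := hFTC0 0 1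
    rw [e1, e2, e3, e4, one_smul, zero_smul, two_smul ℝ (h z)]
    abel
  -- norm bounds, in `ℝ≥0∞`
  have hop : ∀ σ : ℝ, ‖fderiv ℝ (fderiv ℝ h) (σ • z) z z‖ₑ ≤
      ‖iteratedFDeriv ℝ 2 h (σ • z)‖ₑ * ‖z‖ₑ ^ 2 := by
    intro σ
    have h1 : ‖fderiv ℝ (fderiv ℝ h) (σ • z) z z‖ ≤ ‖iteratedFDeriv ℝ 2 h (σ • z)‖ * ‖z‖ ^ 2 := by
      calc ‖fderiv ℝ (fderiv ℝ h) (σ • z) z z‖ ≤ ‖fderiv ℝ (fderiv ℝ h) (σ • z) z‖ * ‖z‖ :=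
            ContinuousLinearMap.le_opNorm _ _
        _ ≤ ‖fderiv ℝ (fderiv ℝ h) (σ • z)‖ * ‖z‖ * ‖z‖ := by
            gcongr; exact ContinuousLinearMap.le_opNorm _ _
        _ = ‖iteratedFDeriv ℝ 2 h (σ • z)‖ * ‖z‖ ^ 2 := by
            rw [norm_fderiv_fderiv_eq_norm_iteratedFDeriv_two]; ring
    calc ‖fderiv ℝ (fderiv ℝ h) (σ • z) z z‖ₑ = ENNReal.ofReal ‖fderiv ℝ (fderiv ℝ h) (σ • z) z z‖ :=
          (ofReal_norm _).symm
      _ ≤ ENNReal.ofReal (‖iteratedFDeriv ℝ 2 h (σ • z)‖ * ‖z‖ ^ 2) := ENNReal.ofReal_le_ofReal h1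
      _ = ‖iteratedFDeriv ℝ 2 h (σ • z)‖ₑ * ‖z‖ₑ ^ 2 := by
          rw [ENNReal.ofReal_mul (norm_nonneg _), ofReal_norm, ENNReal.ofReal_pow (norm_nonneg _),
            ofReal_norm]
  rw [hΔ, intervalIntegral.integral_of_le zero_le_one]
  refine (enorm_integral_le_lintegral_enorm _).trans (lintegral_mono fun t => ?_)
  rw [intervalIntegral.integral_of_le zero_le_one]
  exact (enorm_integral_le_lintegral_enorm _).trans (lintegral_mono fun s => hop (s + t))

/-! ### The weight `∫₀¹∫₀¹ (s+t)^{-3/2} ds dt ≤ 4` -/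

/-- For `c > 0`: `(c³)⁻¹ (c³)^{1/2} = c^{-3/2}`. [folklore] -/
private theorem weight_eq_rpow {c : ℝ} (hc : 0 < c) :
    (c ^ 3)⁻¹ * (c ^ 3) ^ (1 / 2 : ℝ) = c ^ (-(3 / 2 : ℝ)) := by
  rw [← Real.rpow_natCast c 3, ← Real.rpow_mul hc.le, ← Real.rpow_neg hc.le, ← Real.rpow_add hc]
  norm_num

/-- **The weight of the averaged second difference is finite:**
`∫₀¹∫₀¹ (s+t)^{-3/2} ds dt ≤ 4` (exactly `8 − 4√2`; inner integral `2t^{-1/2} − 2(1+t)^{-1/2} ≤ 2t^{-1/2}`,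
then `∫₀¹ 2t^{-1/2} dt = 4`), written with the weight in the form `(c³)⁻¹ (c³)^{1/2}` produced by the
Haar scaling of balls in dimension `3`. [folklore] -/
private theorem lintegral_second_difference_weight_le :
    ∫⁻ t in Ioc (0 : ℝ) 1, ∫⁻ s in Ioc (0 : ℝ) 1,
        ENNReal.ofReal (((s + t) ^ 3)⁻¹ * ((s + t) ^ 3) ^ (1 / 2 : ℝ)) ≤ 4 := by
  -- inner integral
  have hinner : ∀ t ∈ Ioc (0 : ℝ) 1, ∫⁻ s in Ioc (0 : ℝ) 1,
      ENNReal.ofReal (((s + t) ^ 3)⁻¹ * ((s + t) ^ 3) ^ (1 / 2 : ℝ)) ≤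
        ENNReal.ofReal (2 * t ^ (-(1 / 2 : ℝ))) := by
    intro t ht
    have ht0 : 0 < t := ht.1
    have hcongr : ∀ s ∈ Ioc (0 : ℝ) 1, ENNReal.ofReal (((s + t) ^ 3)⁻¹ * ((s + t) ^ 3) ^ (1 / 2 : ℝ)) =
        ENNReal.ofReal ((s + t) ^ (-(3 / 2 : ℝ))) := fun s hs => by
      rw [weight_eq_rpow (by linarith [hs.1])]
    rw [setLIntegral_congr_fun measurableSet_Ioc hcongr]
    -- continuity of the integrand on `[0, 1]` (as `t > 0`)
    have hcont : ContinuousOn (fun s : ℝ => (s + t) ^ (-(3 / 2 : ℝ))) (Icc 0 1) := by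
      refine ContinuousOn.rpow_const (continuousOn_id.add continuousOn_const) fun s hs => ?_
      left; exact (by linarith [hs.1] : (0 : ℝ) < s + t).ne'
    have hint : IntegrableOn (fun s : ℝ => (s + t) ^ (-(3 / 2 : ℝ))) (Ioc 0 1) volume :=
      (hcont.integrableOn_Icc).mono_set Ioc_subset_Icc_self
    have hnn : 0 ≤ᵐ[volume.restrict (Ioc (0 : ℝ) 1)] fun s : ℝ => (s + t) ^ (-(3 / 2 : ℝ)) := by
      refine (ae_restrict_mem measurableSet_Ioc).mono fun s hs => ?_
      exact Real.rpow_nonneg (by linarith [hs.1]) _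
    rw [← ofReal_integral_eq_lintegral_ofReal hint hnn, ← intervalIntegral.integral_of_le zero_le_one]
    -- evaluate: `∫₀¹ (s+t)^{-3/2} ds = ∫ₜ^{1+t} u^{-3/2} du = 2 t^{-1/2} − 2 (1+t)^{-1/2}`
    have hshift : ∫ s in (0 : ℝ)..1, (s + t) ^ (-(3 / 2 : ℝ)) =
        ∫ u in (0 + t : ℝ)..(1 + t), u ^ (-(3 / 2 : ℝ)) :=
      intervalIntegral.integral_comp_add_right (fun u : ℝ => u ^ (-(3 / 2 : ℝ))) t
    have h0mem : (0 : ℝ) ∉ Set.uIcc (0 + t) (1 + t) := by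
      rw [Set.uIcc_of_le (by linarith)]
      intro h
      linarith [h.1]
    have heval : ∫ u in (0 + t : ℝ)..(1 + t), u ^ (-(3 / 2 : ℝ)) =
        ((1 + t) ^ (-(3 / 2 : ℝ) + 1) - (0 + t) ^ (-(3 / 2 : ℝ) + 1)) / (-(3 / 2 : ℝ) + 1) :=
      integral_rpow (Or.inr ⟨by norm_num, h0mem⟩)
    rw [hshift, heval, zero_add]
    refine ENNReal.ofReal_le_ofReal ?_
    have hexp : (-(3 / 2 : ℝ) + 1) = -(1 / 2 : ℝ) := by norm_num
    rw [hexp]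
    have h1 : 0 ≤ (1 + t) ^ (-(1 / 2 : ℝ)) := Real.rpow_nonneg (by linarith) _
    have h2 : ((1 + t) ^ (-(1 / 2 : ℝ)) - t ^ (-(1 / 2 : ℝ))) / (-(1 / 2 : ℝ)) =
        2 * t ^ (-(1 / 2 : ℝ)) - 2 * (1 + t) ^ (-(1 / 2 : ℝ)) := by ring
    rw [h2]
    linarith
  -- outer integral
  have hmeas : Measurable fun t : ℝ => ENNReal.ofReal (2 * t ^ (-(1 / 2 : ℝ))) :=
    (measurable_const.mul (measurable_id.pow_const _)).ennreal_ofReal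
  calc ∫⁻ t in Ioc (0 : ℝ) 1, ∫⁻ s in Ioc (0 : ℝ) 1,
        ENNReal.ofReal (((s + t) ^ 3)⁻¹ * ((s + t) ^ 3) ^ (1 / 2 : ℝ))
      ≤ ∫⁻ t in Ioc (0 : ℝ) 1, ENNReal.ofReal (2 * t ^ (-(1 / 2 : ℝ))) :=
        setLIntegral_mono' measurableSet_Ioc hinner
    _ = ENNReal.ofReal (∫ t in (0 : ℝ)..1, 2 * t ^ (-(1 / 2 : ℝ))) := by
        have hint : IntegrableOn (fun t : ℝ => 2 * t ^ (-(1 / 2 : ℝ))) (Ioc 0 1) volume :=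
          ((intervalIntegral.intervalIntegrable_rpow' (a := 0) (b := 1)
            (by norm_num : (-1 : ℝ) < -(1 / 2 : ℝ))).1).const_mul 2
        have hnn : 0 ≤ᵐ[volume.restrict (Ioc (0 : ℝ) 1)] fun t : ℝ => 2 * t ^ (-(1 / 2 : ℝ)) := by
          refine (ae_restrict_mem measurableSet_Ioc).mono fun t ht => ?_
          exact mul_nonneg zero_le_two (Real.rpow_nonneg ht.1.le _)
        rw [intervalIntegral.integral_of_le zero_le_one, ofReal_integral_eq_lintegral_ofReal hint hnn]
    _ = 4 := by
        rw [intervalIntegral.integral_const_mul, integral_rpow (Or.inl (by norm_num))]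
        have e : (-(1 / 2 : ℝ) + 1) = (1 / 2 : ℝ) := by norm_num
        rw [e, Real.zero_rpow (by norm_num), Real.one_rpow]
        norm_num

/-! ### The pointwise inequality on a three-dimensional space with a Haar measure -/

section DimThree

variable [MeasurableSpace E] [BorelSpace E] [FiniteDimensional ℝ E] (μ : Measure E)
  [μ.IsAddHaarMeasure]

omit [MeasurableSpace E] [BorelSpace E] [NormedAddCommGroup E] [NormedSpace ℝ E]
  [FiniteDimensional ℝ E] [μ.IsAddHaarMeasure] in
/-- Cauchy–Schwarz on a set: `∫_S ‖g‖ ≤ ‖g‖_{L²(μ)} μ(S)^{1/2}`. [folklore] -/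
private theorem setLIntegral_enorm_le_eLpNorm_two_mul {α : Type*} [MeasurableSpace α]
    (μ' : Measure α) {G : Type*} [NormedAddCommGroup G]
    {g : α → G} (hg : AEStronglyMeasurable g μ') (S : Set α) :
    ∫⁻ w in S, ‖g w‖ₑ ∂μ' ≤ eLpNorm g 2 μ' * μ' S ^ (1 / 2 : ℝ) := by
  calc ∫⁻ w in S, ‖g w‖ₑ ∂μ' = eLpNorm g 1 (μ'.restrict S) := eLpNorm_one_eq_lintegral_enorm.symm
    _ ≤ eLpNorm g 2 (μ'.restrict S) *
          (μ'.restrict S) univ ^ (1 / (1 : ℝ≥0∞).toReal - 1 / (2 : ℝ≥0∞).toReal) :=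
        eLpNorm_le_eLpNorm_mul_rpow_measure_univ (by norm_num) hg.restrict
    _ ≤ eLpNorm g 2 μ' * μ' S ^ (1 / 2 : ℝ) := by
        rw [Measure.restrict_apply_univ]
        have hexp : 1 / (1 : ℝ≥0∞).toReal - 1 / (2 : ℝ≥0∞).toReal = (1 / 2 : ℝ) := by norm_num
        rw [hexp]
        gcongr
        exact Measure.restrict_le_self

/-- Haar scaling of balls in dimension `3`: `μ(B_{cρ}) = c³ μ(B_ρ)` for `c, ρ > 0`. [folklore] -/
private theorem measure_ball_smul_eq (hE : finrank ℝ E = 3) {c ρ : ℝ} (hc : 0 < c) (hρ : 0 < ρ) :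
    μ (ball (0 : E) (c * ρ)) = ENNReal.ofReal (c ^ 3) * μ (ball (0 : E) ρ) := by
  rw [Measure.addHaar_ball_of_pos μ (0 : E) (mul_pos hc hρ), Measure.addHaar_ball_of_pos μ (0 : E) hρ,
    hE, mul_pow, ENNReal.ofReal_mul (pow_nonneg hc.le 3), mul_assoc]

/-- The scaled-ball bound: for `c, ρ > 0` and a continuous `g` with `‖g‖ₑ`-density `G`,
`∫_{B_ρ} ‖g(c z)‖ dμ(z) ≤ ‖g‖_{L²(μ)} μ(B_ρ)^{1/2} (c³)⁻¹ (c³)^{1/2}` (substitute `w = c z`,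
Jacobian `c⁻³`, then Cauchy–Schwarz on `B_{cρ}`). [folklore] -/
private theorem setLIntegral_enorm_comp_smul_le (hE : finrank ℝ E = 3) {G' : Type*}
    [NormedAddCommGroup G'] {g : E → G'} (hg : Continuous g) {c ρ : ℝ} (hc : 0 < c) (hρ : 0 < ρ) :
    ∫⁻ z in ball (0 : E) ρ, ‖g (c • z)‖ₑ ∂μ ≤
      eLpNorm g 2 μ * μ (ball (0 : E) ρ) ^ (1 / 2 : ℝ) *
        ENNReal.ofReal ((c ^ 3)⁻¹ * (c ^ 3) ^ (1 / 2 : ℝ)) := by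
  set B := ball (0 : E) ρ with hB
  set Gc : E → ℝ≥0∞ := (ball (0 : E) (c * ρ)).indicator fun w => ‖g w‖ₑ with hGc
  have hGm : Measurable Gc := (continuous_enorm.comp hg).measurable.indicator measurableSet_ball
  have hmem : ∀ z : E, c • z ∈ ball (0 : E) (c * ρ) ↔ z ∈ B := by
    intro z
    rw [mem_ball_zero_iff, hB, mem_ball_zero_iff, norm_smul, Real.norm_of_nonneg hc.le]
    exact ⟨fun h' => lt_of_mul_lt_mul_left h' hc.le, fun h' => mul_lt_mul_of_pos_left h' hc⟩
  calc ∫⁻ z in B, ‖g (c • z)‖ₑ ∂μ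
      = ∫⁻ z, B.indicator (fun z => ‖g (c • z)‖ₑ) z ∂μ := (lintegral_indicator measurableSet_ball _).symm
    _ = ∫⁻ z, Gc (c • z) ∂μ := by
        refine lintegral_congr fun z => ?_
        by_cases hz : z ∈ B
        · rw [indicator_of_mem hz, hGc, indicator_of_mem ((hmem z).2 hz)]
        · rw [indicator_of_notMem hz, hGc, indicator_of_notMem (fun h' => hz ((hmem z).1 h'))]
    _ = ∫⁻ w, Gc w ∂(Measure.map (fun z : E => c • z) μ) :=
        (lintegral_map hGm (measurable_const_smul c)).symm
    _ = ENNReal.ofReal (|(c ^ 3)⁻¹|) * ∫⁻ w in ball (0 : E) (c * ρ), ‖g w‖ₑ ∂μ := by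
        rw [Measure.map_addHaar_smul μ hc.ne', lintegral_smul_measure, hGc,
          lintegral_indicator measurableSet_ball, smul_eq_mul, hE]
    _ ≤ ENNReal.ofReal ((c ^ 3)⁻¹) * (eLpNorm g 2 μ * μ (ball (0 : E) (c * ρ)) ^ (1 / 2 : ℝ)) := by
        rw [abs_of_nonneg (by positivity)]
        gcongr
        exact setLIntegral_enorm_le_eLpNorm_two_mul μ hg.aestronglyMeasurable _
    _ = eLpNorm g 2 μ * μ B ^ (1 / 2 : ℝ) * ENNReal.ofReal ((c ^ 3)⁻¹ * (c ^ 3) ^ (1 / 2 : ℝ)) := by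
        rw [measure_ball_smul_eq μ hE hc hρ, ENNReal.mul_rpow_of_nonneg _ _ (by norm_num : (0:ℝ) ≤ 1 / 2),
          ENNReal.ofReal_rpow_of_pos (pow_pos hc 3),
          ENNReal.ofReal_mul (inv_nonneg.2 (pow_nonneg hc.le 3))]
        ring

/-- **Pointwise sup bound from a ball average of second differences** (dimension `3`, any Haar
measure `μ`, any radius `ρ > 0`): for a `C²` map `h`,
`μ(B_ρ) ‖h(0)‖ ≤ (5/2) μ(B_ρ)^{1/2} ‖h‖_{L²(μ)} + 4ρ² μ(B_ρ)^{1/2} ‖D²h‖_{L²(μ)}`.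
Proof: `h(0) = 2h(z) − h(2z) + Δ²_z` with `‖Δ²_z‖ ≤ ρ² ∫₀¹∫₀¹ ‖D²h((s+t)z)‖` for `z ∈ B_ρ`
(`enorm_second_difference_le`); integrate over `B_ρ`; the two value terms by Cauchy–Schwarz on
`B_ρ` and (after `w = 2z`) on `B_{2ρ}` (`8^{-1/2} ≤ 1/2`); the Hessian term by Tonelli, the scaled-ball
bound for each `(s, t)` and `∫₀¹∫₀¹(s+t)^{-3/2} ≤ 4`. The averaging pattern is that of Adams' proof of
the imbedding `W^{2,2}(ℝ³) ⊂ C_B` (Lemma 5.15/5.17), one derivative higher and with the constants kept.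
[cite: Adams1975, Thm. 5.4 Part I Case C (mp > n) and Lemma 5.15] -/
theorem second_difference_pointwise [CompleteSpace F] (hE : finrank ℝ E = 3) {h : E → F}
    (hh : ContDiff ℝ 2 h) {ρ : ℝ} (hρ : 0 < ρ) :
    μ (ball (0 : E) ρ) * ‖h 0‖ₑ ≤
      ENNReal.ofReal (5 / 2) * μ (ball (0 : E) ρ) ^ (1 / 2 : ℝ) * eLpNorm h 2 μ +
        4 * ENNReal.ofReal (ρ ^ 2) * μ (ball (0 : E) ρ) ^ (1 / 2 : ℝ) *
          eLpNorm (fun w => iteratedFDeriv ℝ 2 h w) 2 μ := by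
  set B := ball (0 : E) ρ with hB
  set I := Ioc (0 : ℝ) 1 with hI
  set N₀ := eLpNorm h 2 μ with hN₀
  set N₂ := eLpNorm (fun w => iteratedFDeriv ℝ 2 h w) 2 μ with hN₂
  have hcont : Continuous h := hh.continuous
  have hD2cont : Continuous fun w => iteratedFDeriv ℝ 2 h w := hh.continuous_iteratedFDeriv le_rfl
  set G : E → ℝ≥0∞ := fun w => ‖iteratedFDeriv ℝ 2 h w‖ₑ with hG
  have hGm : Measurable G := (continuous_enorm.comp hD2cont).measurable
  -- Step 1: the pointwise inequality on `B`
  have h1 : ∀ z ∈ B, ‖h 0‖ₑ ≤ 2 * ‖h z‖ₑ + ‖h ((2 : ℝ) • z)‖ₑ +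
      ENNReal.ofReal (ρ ^ 2) * ∫⁻ t in I, ∫⁻ s in I, G ((s + t) • z) := by
    intro z hz
    have hzρ : ‖z‖ ≤ ρ := (mem_ball_zero_iff.1 hz).le
    -- real triangle inequality
    have hreal : ‖h 0‖ ≤ 2 * ‖h z‖ + ‖h ((2 : ℝ) • z)‖ + ‖h ((2 : ℝ) • z) - (2 : ℝ) • h z + h 0‖ := by
      have e : h 0 = (h ((2 : ℝ) • z) - (2 : ℝ) • h z + h 0) - h ((2 : ℝ) • z) + (2 : ℝ) • h z := by abel
      calc ‖h 0‖ = ‖(h ((2 : ℝ) • z) - (2 : ℝ) • h z + h 0) - h ((2 : ℝ) • z) + (2 : ℝ) • h z‖ := by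
            rw [← e]
        _ ≤ ‖h ((2 : ℝ) • z) - (2 : ℝ) • h z + h 0‖ + ‖h ((2 : ℝ) • z)‖ + ‖(2 : ℝ) • h z‖ :=
            (norm_add_le _ _).trans (add_le_add (norm_sub_le _ _) le_rfl)
        _ = 2 * ‖h z‖ + ‖h ((2 : ℝ) • z)‖ + ‖h ((2 : ℝ) • z) - (2 : ℝ) • h z + h 0‖ := by
            rw [norm_smul, Real.norm_of_nonneg zero_le_two]; ring
    have hΔ := enorm_second_difference_le hh z
    have hz2 : ‖z‖ₑ ^ 2 ≤ ENNReal.ofReal (ρ ^ 2) := by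
      rw [← ofReal_norm, ← ENNReal.ofReal_pow (norm_nonneg _)]
      exact ENNReal.ofReal_le_ofReal (pow_le_pow_left₀ (norm_nonneg _) hzρ 2)
    have hΔ' : ‖h ((2 : ℝ) • z) - (2 : ℝ) • h z + h 0‖ₑ ≤
        ENNReal.ofReal (ρ ^ 2) * ∫⁻ t in I, ∫⁻ s in I, G ((s + t) • z) := by
      refine hΔ.trans ?_
      calc ∫⁻ t in I, ∫⁻ s in I, ‖iteratedFDeriv ℝ 2 h ((s + t) • z)‖ₑ * ‖z‖ₑ ^ 2
          ≤ ∫⁻ t in I, ∫⁻ s in I, G ((s + t) • z) * ENNReal.ofReal (ρ ^ 2) :=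
            lintegral_mono fun t => lintegral_mono fun s => by rw [hG]; gcongr
        _ = ENNReal.ofReal (ρ ^ 2) * ∫⁻ t in I, ∫⁻ s in I, G ((s + t) • z) := by
            rw [mul_comm, ← lintegral_mul_const' _ _ ENNReal.ofReal_ne_top]
            refine lintegral_congr fun t => ?_
            rw [lintegral_mul_const' _ _ ENNReal.ofReal_ne_top]
    calc ‖h 0‖ₑ = ENNReal.ofReal ‖h 0‖ := (ofReal_norm _).symm
      _ ≤ ENNReal.ofReal (2 * ‖h z‖ + ‖h ((2 : ℝ) • z)‖ + ‖h ((2 : ℝ) • z) - (2 : ℝ) • h z + h 0‖) :=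
          ENNReal.ofReal_le_ofReal hreal
      _ = 2 * ‖h z‖ₑ + ‖h ((2 : ℝ) • z)‖ₑ + ‖h ((2 : ℝ) • z) - (2 : ℝ) • h z + h 0‖ₑ := by
          rw [ENNReal.ofReal_add (by positivity) (norm_nonneg _),
            ENNReal.ofReal_add (by positivity) (norm_nonneg _), ENNReal.ofReal_mul zero_le_two,
            ofReal_norm, ofReal_norm, ofReal_norm, ENNReal.ofReal_ofNat]
      _ ≤ _ := by gcongr
  -- Step 2: integrate over `B`
  have hm0 : Measurable fun z : E => ‖h z‖ₑ := (continuous_enorm.comp hcont).measurable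
  have hm0' : Measurable fun z : E => 2 * ‖h z‖ₑ := hm0.const_mul 2
  have hm2 : Measurable fun z : E => ‖h ((2 : ℝ) • z)‖ₑ :=
    (continuous_enorm.comp (hcont.comp (continuous_const_smul (2 : ℝ)))).measurable
  have hmeas1 : Measurable fun z : E => 2 * ‖h z‖ₑ + ‖h ((2 : ℝ) • z)‖ₑ := hm0'.add hm2
  have h2 : μ B * ‖h 0‖ₑ ≤ 2 * (∫⁻ z in B, ‖h z‖ₑ ∂μ) + (∫⁻ z in B, ‖h ((2 : ℝ) • z)‖ₑ ∂μ) +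
      ENNReal.ofReal (ρ ^ 2) * ∫⁻ z in B, ∫⁻ t in I, ∫⁻ s in I, G ((s + t) • z) ∂volume ∂volume ∂μ := by
    calc μ B * ‖h 0‖ₑ = ∫⁻ _ in B, ‖h 0‖ₑ ∂μ := by rw [setLIntegral_const, mul_comm]
      _ ≤ ∫⁻ z in B, (2 * ‖h z‖ₑ + ‖h ((2 : ℝ) • z)‖ₑ +
            ENNReal.ofReal (ρ ^ 2) * ∫⁻ t in I, ∫⁻ s in I, G ((s + t) • z)) ∂μ :=
          setLIntegral_mono' measurableSet_ball h1
      _ = (∫⁻ z in B, (2 * ‖h z‖ₑ + ‖h ((2 : ℝ) • z)‖ₑ) ∂μ) +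
            ∫⁻ z in B, ENNReal.ofReal (ρ ^ 2) * ∫⁻ t in I, ∫⁻ s in I, G ((s + t) • z) ∂volume ∂volume ∂μ :=
          lintegral_add_left hmeas1 _
      _ = 2 * (∫⁻ z in B, ‖h z‖ₑ ∂μ) + (∫⁻ z in B, ‖h ((2 : ℝ) • z)‖ₑ ∂μ) +
            ENNReal.ofReal (ρ ^ 2) * ∫⁻ z in B, ∫⁻ t in I, ∫⁻ s in I, G ((s + t) • z) ∂volume ∂volume ∂μ := by
          rw [lintegral_add_left hm0', lintegral_const_mul _ hm0,
            lintegral_const_mul' _ _ ENNReal.ofReal_ne_top]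
  -- Step 3: the two value terms
  have h3a : ∫⁻ z in B, ‖h z‖ₑ ∂μ ≤ N₀ * μ B ^ (1 / 2 : ℝ) :=
    setLIntegral_enorm_le_eLpNorm_two_mul μ hcont.aestronglyMeasurable B
  have h3b : ∫⁻ z in B, ‖h ((2 : ℝ) • z)‖ₑ ∂μ ≤ ENNReal.ofReal (1 / 2) * (N₀ * μ B ^ (1 / 2 : ℝ)) := by
    have h := setLIntegral_enorm_comp_smul_le μ hE hcont (by norm_num : (0 : ℝ) < 2) hρ
    refine h.trans ?_
    have hw : ENNReal.ofReal (((2 : ℝ) ^ 3)⁻¹ * ((2 : ℝ) ^ 3) ^ (1 / 2 : ℝ)) ≤ ENNReal.ofReal (1 / 2) := by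
      refine ENNReal.ofReal_le_ofReal ?_
      have h8 : ((2 : ℝ) ^ 3) ^ (1 / 2 : ℝ) ≤ 3 := by
        rw [show ((2 : ℝ) ^ 3) = 8 by norm_num]
        have h9 : (8 : ℝ) ^ (1 / 2 : ℝ) ≤ (9 : ℝ) ^ (1 / 2 : ℝ) :=
          Real.rpow_le_rpow (by norm_num) (by norm_num) (by norm_num)
        have h99 : (9 : ℝ) ^ (1 / 2 : ℝ) = 3 := by
          rw [show (9 : ℝ) = 3 ^ (2 : ℝ) by norm_num, ← Real.rpow_mul (by norm_num)]
          norm_num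
        linarith
      have h0 : 0 ≤ ((2 : ℝ) ^ 3) ^ (1 / 2 : ℝ) := Real.rpow_nonneg (by norm_num) _
      nlinarith
    calc N₀ * μ B ^ (1 / 2 : ℝ) * ENNReal.ofReal (((2 : ℝ) ^ 3)⁻¹ * ((2 : ℝ) ^ 3) ^ (1 / 2 : ℝ))
        ≤ N₀ * μ B ^ (1 / 2 : ℝ) * ENNReal.ofReal (1 / 2) := by gcongr
      _ = ENNReal.ofReal (1 / 2) * (N₀ * μ B ^ (1 / 2 : ℝ)) := by ring
  -- Step 4: the Hessian term — Tonelli twice, the scaled-ball bound, and the weight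
  have hGc3 : Measurable fun q : (E × ℝ) × ℝ => G ((q.2 + q.1.2) • q.1.1) :=
    (continuous_enorm.comp (hD2cont.comp
      ((continuous_snd.add (continuous_snd.comp continuous_fst)).smul
        (continuous_fst.comp continuous_fst)))).measurable
  have hswap1 : ∫⁻ z in B, ∫⁻ t in I, ∫⁻ s in I, G ((s + t) • z) ∂volume ∂volume ∂μ =
      ∫⁻ t in I, ∫⁻ z in B, ∫⁻ s in I, G ((s + t) • z) ∂volume ∂μ ∂volume := by
    apply lintegral_lintegral_swap
    exact (hGc3.lintegral_prod_right' (ν := volume.restrict I)).aemeasurable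
  have hswap2 : ∀ t : ℝ, ∫⁻ z in B, ∫⁻ s in I, G ((s + t) • z) ∂volume ∂μ =
      ∫⁻ s in I, ∫⁻ z in B, G ((s + t) • z) ∂μ ∂volume := by
    intro t
    apply lintegral_lintegral_swap
    have : Continuous fun q : E × ℝ => G ((q.2 + t) • q.1) :=
      continuous_enorm.comp (hD2cont.comp ((continuous_snd.add continuous_const).smul continuous_fst))
    exact this.measurable.aemeasurable
  have h4a : ∀ t ∈ I, ∀ s ∈ I, ∫⁻ z in B, G ((s + t) • z) ∂μ ≤
      N₂ * μ B ^ (1 / 2 : ℝ) * ENNReal.ofReal ((((s + t) ^ 3)⁻¹) * ((s + t) ^ 3) ^ (1 / 2 : ℝ)) := by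
    intro t ht s hs
    have hc : 0 < s + t := by linarith [hs.1, ht.1]
    exact setLIntegral_enorm_comp_smul_le μ hE hD2cont hc hρ
  have hwm : Measurable fun q : ℝ × ℝ =>
      ENNReal.ofReal ((((q.2 + q.1) ^ 3)⁻¹) * ((q.2 + q.1) ^ 3) ^ (1 / 2 : ℝ)) :=
    ((((measurable_snd.add measurable_fst).pow_const 3).inv).mul
      (((measurable_snd.add measurable_fst).pow_const 3).pow_const _)).ennreal_ofReal
  have h4 : ∫⁻ z in B, ∫⁻ t in I, ∫⁻ s in I, G ((s + t) • z) ∂volume ∂volume ∂μ ≤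
      N₂ * μ B ^ (1 / 2 : ℝ) * 4 := by
    rw [hswap1]
    calc ∫⁻ t in I, ∫⁻ z in B, ∫⁻ s in I, G ((s + t) • z) ∂volume ∂μ ∂volume
        = ∫⁻ t in I, ∫⁻ s in I, ∫⁻ z in B, G ((s + t) • z) ∂μ ∂volume ∂volume :=
          lintegral_congr fun t => hswap2 t
      _ ≤ ∫⁻ t in I, ∫⁻ s in I, N₂ * μ B ^ (1 / 2 : ℝ) *
            ENNReal.ofReal ((((s + t) ^ 3)⁻¹) * ((s + t) ^ 3) ^ (1 / 2 : ℝ)) ∂volume ∂volume :=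
          setLIntegral_mono' measurableSet_Ioc fun t ht =>
            setLIntegral_mono' measurableSet_Ioc fun s hs => h4a t ht s hs
      _ = N₂ * μ B ^ (1 / 2 : ℝ) * ∫⁻ t in I, ∫⁻ s in I,
            ENNReal.ofReal ((((s + t) ^ 3)⁻¹) * ((s + t) ^ 3) ^ (1 / 2 : ℝ)) ∂volume ∂volume := by
          have hWt : Measurable fun t : ℝ => ∫⁻ s in I,
              ENNReal.ofReal ((((s + t) ^ 3)⁻¹) * ((s + t) ^ 3) ^ (1 / 2 : ℝ)) ∂volume :=
            hwm.lintegral_prod_right' (ν := volume.restrict I)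
          have hws : ∀ t : ℝ, Measurable fun s : ℝ =>
              ENNReal.ofReal ((((s + t) ^ 3)⁻¹) * ((s + t) ^ 3) ^ (1 / 2 : ℝ)) := fun t =>
            ((((measurable_id.add_const t).pow_const 3).inv).mul
              (((measurable_id.add_const t).pow_const 3).pow_const _)).ennreal_ofReal
          rw [← lintegral_const_mul _ hWt]
          refine lintegral_congr fun t => ?_
          rw [← lintegral_const_mul _ (hws t)]
      _ ≤ N₂ * μ B ^ (1 / 2 : ℝ) * 4 := by
          gcongr
          exact lintegral_second_difference_weight_le
  -- assemble
  calc μ B * ‖h 0‖ₑ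
      ≤ 2 * (∫⁻ z in B, ‖h z‖ₑ ∂μ) + (∫⁻ z in B, ‖h ((2 : ℝ) • z)‖ₑ ∂μ) +
          ENNReal.ofReal (ρ ^ 2) * ∫⁻ z in B, ∫⁻ t in I, ∫⁻ s in I, G ((s + t) • z) ∂volume ∂volume ∂μ := h2
    _ ≤ 2 * (N₀ * μ B ^ (1 / 2 : ℝ)) + ENNReal.ofReal (1 / 2) * (N₀ * μ B ^ (1 / 2 : ℝ)) +
          ENNReal.ofReal (ρ ^ 2) * (N₂ * μ B ^ (1 / 2 : ℝ) * 4) := by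
        gcongr
    _ = ENNReal.ofReal (5 / 2) * μ B ^ (1 / 2 : ℝ) * N₀ +
          4 * ENNReal.ofReal (ρ ^ 2) * μ B ^ (1 / 2 : ℝ) * N₂ := by
        have e : (2 : ℝ≥0∞) + ENNReal.ofReal (1 / 2) = ENNReal.ofReal (5 / 2) := by
          rw [← ENNReal.ofReal_ofNat 2, ← ENNReal.ofReal_add (by norm_num) (by norm_num)]
          norm_num
        rw [← e]
        ring

end DimThree

/-! ### Lebesgue measure on `ℝ³`: the inequality with numerals -/

section Euclidean

/-- **Explicit sup interpolation between `L²` and `Ḣ²` on `ℝ³`** (Gagliardo–Nirenberg with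
`n = 3, j = 0, m = 2, p = ∞, q = r = 2`, two-parameter form, numerical constants): for a `C²` map
`f : ℝ³ → F` with `‖f‖_{L²} ≤ a` and `‖D²f‖_{L²} ≤ c`, every `ρ > 0` and every `x`,

`‖f(x)‖ ≤ (5/4) ρ^{-3/2} a + 2 ρ^{1/2} c`

(`second_difference_pointwise` for `y ↦ f(y + x)` and Lebesgue measure, `vol(B_ρ) = (4π/3)ρ³ ≥ 4ρ³`).
Optimising in `ρ` gives `‖f‖_∞ ≤ 3.2 a^{1/4} c^{3/4}`; with `ρ = κ` it turns a weighted energy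
`‖f‖₂² + κ⁴‖D²f‖₂² ≤ ℰ` into `‖f‖_∞ ≤ (13/4) κ^{-3/2} √ℰ`. No Sobolev or Agmon constant enters.
[cite: Nirenberg1959, Lecture II, Theorem (the inequality |Dʲu|_p ≤ C |Dᵐu|_r^a |u|_q^{1-a}), case n = 3, j = 0, m = 2, p = ∞, q = r = 2]
[cite: Adams1975, Thm. 5.4 Part I Case C (mp > n)] -/
theorem norm_le_sup_interpolation_two [CompleteSpace F] {f : EuclideanSpace ℝ (Fin 3) → F}
    (hf : ContDiff ℝ 2 f) {a c : ℝ} (ha : 0 ≤ a) (hc : 0 ≤ c)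
    (h0 : eLpNorm f 2 volume ≤ ENNReal.ofReal a)
    (h2 : eLpNorm (fun y => iteratedFDeriv ℝ 2 f y) 2 volume ≤ ENNReal.ofReal c)
    {ρ : ℝ} (hρ : 0 < ρ) (x : EuclideanSpace ℝ (Fin 3)) :
    ‖f x‖ ≤ 5 / 4 * ρ ^ (-(3 / 2 : ℝ)) * a + 2 * ρ ^ (1 / 2 : ℝ) * c := by
  -- translate to the origin
  set h : EuclideanSpace ℝ (Fin 3) → F := fun y => f (y + x) with hh_def
  have hh : ContDiff ℝ 2 h := hf.comp (contDiff_id.add contDiff_const)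
  have hh0 : h 0 = f x := by simp [hh_def]
  have hN₀ : eLpNorm h 2 volume = eLpNorm f 2 volume :=
    eLpNorm_comp_add_right (μ := volume) f x (by norm_num) (by norm_num)
  have hN₂ : eLpNorm (fun y => iteratedFDeriv ℝ 2 h y) 2 volume =
      eLpNorm (fun y => iteratedFDeriv ℝ 2 f y) 2 volume := by
    have e : (fun y => iteratedFDeriv ℝ 2 h y) = fun y => (fun w => iteratedFDeriv ℝ 2 f w) (y + x) := by
      funext y
      simp only [hh_def]
      exact iteratedFDeriv_comp_add_right 2 x y
    rw [e]
    exact eLpNorm_comp_add_right (μ := volume) (fun w => iteratedFDeriv ℝ 2 f w) x (by norm_num)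
      (by norm_num)
  -- the pointwise inequality at the origin for `h`
  have hE : finrank ℝ (EuclideanSpace ℝ (Fin 3)) = 3 := finrank_euclideanSpace_fin
  have key := second_difference_pointwise (volume : Measure (EuclideanSpace ℝ (Fin 3))) hE hh hρ
  rw [hh0, hN₀, hN₂] at key
  -- the volume of the ball
  set v : ℝ := ρ ^ 3 * (Real.pi * 4 / 3) with hv
  have hv0 : 0 < v := by rw [hv]; positivity
  have hV : volume (ball (0 : EuclideanSpace ℝ (Fin 3)) ρ) = ENNReal.ofReal v := by
    rw [EuclideanSpace.volume_ball_fin_three, hv, ENNReal.ofReal_mul (pow_nonneg hρ.le 3),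
      ENNReal.ofReal_pow hρ.le]
  set q : ℝ := v ^ (1 / 2 : ℝ) with hq
  have hq0 : 0 < q := Real.rpow_pos_of_pos hv0 _
  have hVq : ENNReal.ofReal v ^ (1 / 2 : ℝ) = ENNReal.ofReal q := by
    rw [hq, ENNReal.ofReal_rpow_of_nonneg hv0.le (by norm_num)]
  rw [hV] at key
  rw [hVq] at key
  -- pass to real numbers
  have hR : ENNReal.ofReal v * ‖f x‖ₑ ≤
      ENNReal.ofReal (5 / 2 * q * a + 4 * ρ ^ 2 * q * c) := by
    refine key.trans ?_
    calc ENNReal.ofReal (5 / 2) * ENNReal.ofReal q * eLpNorm f 2 volume +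
          4 * ENNReal.ofReal (ρ ^ 2) * ENNReal.ofReal q * eLpNorm (fun y => iteratedFDeriv ℝ 2 f y) 2 volume
        ≤ ENNReal.ofReal (5 / 2) * ENNReal.ofReal q * ENNReal.ofReal a +
          4 * ENNReal.ofReal (ρ ^ 2) * ENNReal.ofReal q * ENNReal.ofReal c := by gcongr
      _ = ENNReal.ofReal (5 / 2 * q * a + 4 * ρ ^ 2 * q * c) := by
          rw [← ENNReal.ofReal_ofNat 4, ← ENNReal.ofReal_mul (by norm_num), ← ENNReal.ofReal_mul (by positivity),
            ← ENNReal.ofReal_mul (by norm_num), ← ENNReal.ofReal_mul (by positivity),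
            ← ENNReal.ofReal_mul (by positivity), ← ENNReal.ofReal_add (by positivity) (by positivity)]
  have hreal : v * ‖f x‖ ≤ 5 / 2 * q * a + 4 * ρ ^ 2 * q * c := by
    have h1 : ENNReal.ofReal (v * ‖f x‖) ≤ ENNReal.ofReal (5 / 2 * q * a + 4 * ρ ^ 2 * q * c) := by
      rw [ENNReal.ofReal_mul hv0.le, ofReal_norm]; exact hR
    exact (ENNReal.ofReal_le_ofReal_iff (by positivity)).1 h1
  -- `q = ρ^{3/2} (4π/3)^{1/2} ≥ 2 ρ^{3/2}` and `q² = v`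
  have hq2 : q ^ 2 = v := by
    rw [hq, ← Real.rpow_natCast, ← Real.rpow_mul hv0.le]; norm_num
  have hρ32 : 0 < ρ ^ (3 / 2 : ℝ) := Real.rpow_pos_of_pos hρ _
  have hqge : 2 * ρ ^ (3 / 2 : ℝ) ≤ q := by
    -- compare squares
    have hsq : (2 * ρ ^ (3 / 2 : ℝ)) ^ 2 ≤ q ^ 2 := by
      rw [hq2, hv, mul_pow, ← Real.rpow_natCast (ρ ^ (3 / 2 : ℝ)) 2, ← Real.rpow_mul hρ.le]
      norm_num
      nlinarith [Real.pi_gt_three, pow_pos hρ 3, Real.rpow_pos_of_pos hρ 3]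
    nlinarith [hq0, hρ32]
  -- divide
  have hdiv : ‖f x‖ ≤ (5 / 2 * a + 4 * ρ ^ 2 * c) / q := by
    rw [le_div_iff₀ hq0]
    have : v * ‖f x‖ = ‖f x‖ * q * q := by rw [← hq2]; ring
    nlinarith [hreal, norm_nonneg (f x), hq0]
  have hinv : 1 / q ≤ ρ ^ (-(3 / 2 : ℝ)) / 2 := by
    rw [Real.rpow_neg hρ.le, div_le_div_iff₀ hq0 (by norm_num : (0:ℝ) < 2)]
    have : (ρ ^ (3 / 2 : ℝ))⁻¹ * q ≥ (ρ ^ (3 / 2 : ℝ))⁻¹ * (2 * ρ ^ (3 / 2 : ℝ)) :=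
      mul_le_mul_of_nonneg_left hqge (inv_nonneg.2 hρ32.le)
    rw [← mul_assoc, mul_comm ((ρ ^ (3 / 2 : ℝ))⁻¹) 2, mul_assoc, inv_mul_cancel₀ hρ32.ne'] at this
    linarith
  have hρhalf : ρ ^ 2 * ρ ^ (-(3 / 2 : ℝ)) = ρ ^ (1 / 2 : ℝ) := by
    rw [← Real.rpow_natCast ρ 2, ← Real.rpow_add hρ]; norm_num
  calc ‖f x‖ ≤ (5 / 2 * a + 4 * ρ ^ 2 * c) / q := hdiv
    _ = (5 / 2 * a + 4 * ρ ^ 2 * c) * (1 / q) := by ring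
    _ ≤ (5 / 2 * a + 4 * ρ ^ 2 * c) * (ρ ^ (-(3 / 2 : ℝ)) / 2) :=
        mul_le_mul_of_nonneg_left hinv (by positivity)
    _ = 5 / 4 * ρ ^ (-(3 / 2 : ℝ)) * a + 2 * (ρ ^ 2 * ρ ^ (-(3 / 2 : ℝ))) * c := by ring
    _ = 5 / 4 * ρ ^ (-(3 / 2 : ℝ)) * a + 2 * ρ ^ (1 / 2 : ℝ) * c := by rw [hρhalf]

end Euclidean

end Literature.Analysis.FunctionSpaces

end
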